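import Mathlib
import Literature.MathematicalPhysics.QuantumFieldTheory.Balaban1983to89.B5DeltaA169

/-!
# B5 p. 33, Proposition 1.1 AS PRINTED — (1.89)–(1.90) with ONE constant `γ₀(d, a)`, uniformly in
# `k` and `T_η`, for the typed lattice operator `Δ_a` of pass 26 (`B5DeltaA169.DeltaA`)

Source: T. Bałaban, *Propagators and renormalization transformations for lattice gauge
theories. I*, Commun. Math. Phys. 95 (1984) 17–40 (`Balaban1984PropagatorsI`, "B5"), renders
`b2b-balaban-ref1/pages/1984-cmp95-propagators-rt-I/…-p016-x2.png` (journal p. 32) and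
`…-p017-x2.png` (p. 33), read as images this session.

## What the paper prints (verbatim)

p. 32: «… we can easily prove that this expression defines a bounded operator on L²(T_η). It is
bounded also when differentiated two times at most.» … «Thus the third term is well defined by
continuity at p′ = 0 and defines a bounded operator together with its derivatives up to the second»
p. 33: «order. It can be easily calculated that the values at p′ = 0 agree with the second and third
equalities in (1.83). We may conclude the above considerations in the following

**Proposition 1.1.** The operator G is a symmetric operator on L²(T_η) and
  ‖GJ‖, ‖∇GJ‖, ‖G∇*J‖, ‖∇G∇*J‖, ‖∇∇GJ‖, ‖G∇*∇*J‖ ≤ γ₀⁻¹‖J‖,   (1.89)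
with a positive constant γ₀ independent of k, T_η, and depending on d only (if we put a = 1).
This implies the bound from below:
  Δ_a = G⁻¹ ≥ γ₀(Δ + I).   (1.90)»

(`B5.Prop11Printed` is the cell's abstract-carrier transcription of this sentence; the present
module proves its CONTENT for the typed lattice operators, in the module's own concrete terms.)

## What this module types, and certifies in the kernel

The objects are those of passes 3–26: the fine torus `T_η = Tor (fine n M)` (`η = 1/n`, any
`n ≥ 1`, coarse torus `Tor M`, any `M_μ ≥ 1`), complex vector fields `J : T_η × Fin d → ℂ`, the
forward differences `∇_ν = fdiff (fine n M) n ν` and their adjoints `∇_ν^* = star (fdiff …)`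
((1.31); `B5Prop11Plancherel` §3), `Δ = B5Prop11Lower.Lap n M = Σ_ν ∇_ν^*∇_ν`, the position-space
`Δ_a = B5DeltaA169.DeltaA n M a = Δ − ∂P∂* + aQ*Q` of (1.69)/(1.73) (pass 26, = `calDa` of
passes 4–6 by `B5DeltaA169.calDa_eq_DeltaA`), and `G = Δ_a⁻¹` ((1.71), `calG_eq_DeltaA_inv`).

DICTIONARY for the printed norms (recorded in the cell's DIVERGENCE.md, D-pv15g3.3).
(a) `‖·‖` in (1.89) is the norm of `L²(T_η)` with the weight `η^d` of (1.21); on vector / tensor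
fields over the SAME lattice `T_η` both sides of each inequality in (1.89) carry the same factor
`η^{d/2}`, so (1.89) is equivalent to the same inequalities for the unweighted `ℓ²` norms
`l2 u = (Σ_i |u_i|²)^{1/2}` (`= √(B5Prop11Lower.nsq u)`) used below; for the same reason «G is a
symmetric operator on L²(T_η)» is `((DeltaA n M a)⁻¹).IsHermitian`.
(b) `∇ = (∇_ν)_ν` is the vector of all forward differences and `∇*` the corresponding divergence
on tensor fields, so the six printed norms are read as follows (`G = (DeltaA n M a)⁻¹`):
  `‖GJ‖`      : `l2 (G *ᵥ J)`,                       `J` a vector field;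
  `‖∇GJ‖`     : `l2T (grad n M (G *ᵥ J))`,           `(∇B)_ν = ∇_ν B` (a `Fin d`-indexed family);
  `‖G∇*J‖`    : `l2 (G *ᵥ divT n M J)`,              `J = (J_ν)_ν`, `∇*J = Σ_ν ∇_ν^* J_ν`;
  `‖∇G∇*J‖`   : `l2T (grad n M (G *ᵥ divT n M J))`;
  `‖∇∇GJ‖`    : `l2T (grad2 n M (G *ᵥ J))`,          `(∇∇B)_{νν′} = ∇_ν∇_{ν′}B`;
  `‖G∇*∇*J‖`  : `l2 (G *ᵥ divT2 n M J)`,             `J = (J_{νν′})`, `∇*∇*J = Σ ∇_ν^*∇_{ν′}^* J_{νν′}`;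
with `l2T F = (Σ_s l2 (F s)²)^{1/2}` the `ℓ²` norm of a tensor field, and `‖J‖` on the right of
(1.89) the `l2` resp. `l2T` norm of the argument.  Pass 3 (`B5Prop11Plancherel`) certified the
six OPERATOR-norm bounds component by component (`‖∇_ν 𝒢‖ ≤ Cst d a`, …) and recorded the
tensor-form norms as «NOT certified … (2) … elementary, not typed»; they are typed and proved here
(generic `ℓ²` aggregation lemmas `l2T_mulVec_le`, `l2_sum_mulVec_le`, `l2T_sum_mulVec_le`: a
family of `|S|` operators of norm `≤ C` acts with norm `≤ √|S|·C` into / out of `S`-indexed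
tensors), at the cost of factors `√d`, `d` — «depending on d only».

RESULTS (all for every `n ≥ 1`, every `M`, every `a > 0`; `hn : 1 ≤ n`, `ha : 0 < a`):
* `DeltaA_inv_isHermitian`, `DeltaA_inv_posDef` — «The operator G is a symmetric operator»
  (and positive);
* `opNorm_fdiff_fdiff_DeltaA_inv_le`, `opNorm_DeltaA_inv_star_fdiff_star_fdiff_le` — the two
  second-order operator bounds of (1.89) for `G = Δ_a⁻¹` (the other four are in pass 26);
* OUR constant `gammaZero d a := 1/((d+1)²·Cst d a)` (`Cst` = pass 3's (1.89) constant
  `max(γ₀(d,a), 1/a, 1)`), a function of `d` and `a` ONLY — `gammaZero_pos`;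
* `ineq189_G`, `ineq189_gradG`, `ineq189_GdivT`, `ineq189_gradGdivT`, `ineq189_grad2G`,
  `ineq189_GdivT2` — the six inequalities (1.89) in the tensor reading (b) with the constant
  `(gammaZero d a)⁻¹`, and `ineq189_opNorm` (the six componentwise operator-norm bounds with the
  same constant);
* `ineq190` — (1.90) `γ₀(Δ + I) ≤ Δ_a` in the Löwner order, and `ineq190_form` — the same as
  `γ₀⟨A,(Δ+I)A⟩ ≤ ⟨A, Δ_a A⟩` for every vector field `A` (real parts; both forms are real);
* `prop11_lattice` — PROPOSITION 1.1 IN THE PRINTED QUANTIFIER ORDER: for every `d` and `a > 0`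
  there is ONE `γ₀ > 0` (namely `gammaZero d a`) such that FOR ALL `n ≥ 1` («independent of k»,
  `η = L^{-k} = 1/n`) and ALL `M` («T_η»): `G` is symmetric, the six bounds (1.89) hold with `γ₀⁻¹`,
  and (1.90) holds with `γ₀`; `prop11_lattice_one` — the case `a = 1` («depending on d only (if we
  put a = 1)»).

## What is NOT claimed

No value of `γ₀` is attributed to the paper (it prints none; ours is `gammaZero`, far from
optimal).  The momentum-space derivation pp. 31–33 ((1.83)–(1.88)) is formalised in passes 2–6
only in the sense recorded there (the operator is built from the blocks (1.83) and identified with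
`Δ_a⁻¹` by passes 5 and 26).  B5's concrete sizes `n = L^k`, `M_μ = 2L_μ/(L^kε)` are instances of
the arbitrary `n ≥ 1`, `M_μ ≥ 1` here.  The abstract carrier `B5.Setting` (whose other fields
belong to Prop. 1.2) is not instantiated.  Nothing here is progress on a summit; value = kernel
certificate of the printed statement's content for the typed lattice operators.
-/

namespace Literature.MathematicalPhysics.QuantumFieldTheory.Balaban1983to89.B5Prop11Lattice

open scoped BigOperators Matrix ComplexConjugate ComplexOrder Matrix.Norms.L2Operator
open Finset Complex Matrix
open Literature.MathematicalPhysics.QuantumFieldTheory.Balaban1983to89.B4Strip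
open Literature.MathematicalPhysics.QuantumFieldTheory.Balaban1983to89.B5Prop11Fiber
open Literature.MathematicalPhysics.QuantumFieldTheory.Balaban1983to89.B5Prop11Bound
open Literature.MathematicalPhysics.QuantumFieldTheory.Balaban1983to89.B5Prop11Plancherel
open Literature.MathematicalPhysics.QuantumFieldTheory.Balaban1983to89.B5Prop11Inverse
open Literature.MathematicalPhysics.QuantumFieldTheory.Balaban1983to89.B5Prop11Lower
open Literature.MathematicalPhysics.QuantumFieldTheory.Balaban1983to89.B5DeltaA169

noncomputable section

/-! ## §1 `ℓ²` norms of vector and tensor fields; aggregation of operator bounds -/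

section L2

variable {m : Type*} [Fintype m] [DecidableEq m]

/-- `‖u‖ = (Σ_i |u_i|²)^{1/2}`, the `ℓ²` norm (`= √(nsq u)`). [folklore] -/
def l2 (u : m → ℂ) : ℝ := Real.sqrt (nsq u)

/-- `‖F‖ = (Σ_s ‖F_s‖²)^{1/2}` for an `S`-indexed family of fields (a tensor field). [folklore] -/
def l2T {S : Type*} [Fintype S] (F : S → m → ℂ) : ℝ := Real.sqrt (∑ s, nsq (F s))

omit [DecidableEq m] in
/-- `0 ≤ ‖u‖`. [folklore] -/
theorem l2_nonneg (u : m → ℂ) : 0 ≤ l2 u := Real.sqrt_nonneg _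

omit [DecidableEq m] in
/-- `‖u‖² = Σ_i |u_i|²`. [folklore] -/
theorem l2_sq (u : m → ℂ) : l2 u ^ 2 = nsq u := Real.sq_sqrt (nsq_nonneg u)

omit [DecidableEq m] in
/-- `0 ≤ ‖F‖` for tensor fields. [folklore] -/
theorem l2T_nonneg {S : Type*} [Fintype S] (F : S → m → ℂ) : 0 ≤ l2T F := Real.sqrt_nonneg _

omit [DecidableEq m] in
/-- `‖F‖² = Σ_s ‖F_s‖²`. [folklore] -/
theorem l2T_sq {S : Type*} [Fintype S] (F : S → m → ℂ) : l2T F ^ 2 = ∑ s, nsq (F s) :=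
  Real.sq_sqrt (Finset.sum_nonneg fun s _ => nsq_nonneg (F s))

omit [DecidableEq m] in
/-- `‖u‖` is the norm of `u` in `EuclideanSpace ℂ m`. [folklore] -/
theorem l2_eq_norm (u : m → ℂ) : l2 u = ‖(WithLp.toLp 2 u : EuclideanSpace ℂ m)‖ := by
  rw [EuclideanSpace.norm_eq]
  rfl

omit [DecidableEq m] in
/-- `‖0‖ = 0`. [folklore] -/
theorem l2_zero : l2 (0 : m → ℂ) = 0 := by
  simp [l2, nsq]

omit [DecidableEq m] in
/-- triangle inequality `‖u + w‖ ≤ ‖u‖ + ‖w‖`. [folklore] -/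
theorem l2_add_le (u w : m → ℂ) : l2 (u + w) ≤ l2 u + l2 w := by
  rw [l2_eq_norm, l2_eq_norm, l2_eq_norm, WithLp.toLp_add]
  exact norm_add_le _ _

omit [DecidableEq m] in
/-- `‖Σ_i u_i‖ ≤ Σ_i ‖u_i‖`. [folklore] -/
theorem l2_sum_le {ι : Type*} (s : Finset ι) (u : ι → m → ℂ) :
    l2 (∑ i ∈ s, u i) ≤ ∑ i ∈ s, l2 (u i) := by
  classical
  refine Finset.induction_on s ?_ ?_
  · simp [l2_zero]
  · intro i s hi ih
    rw [Finset.sum_insert hi, Finset.sum_insert hi]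
    exact (l2_add_le _ _).trans (by linarith)

/-- `‖X w‖ ≤ ‖X‖ ‖w‖` (operator norm). [folklore] -/
theorem l2_mulVec_le (X : Matrix m m ℂ) (w : m → ℂ) : l2 (X *ᵥ w) ≤ ‖X‖ * l2 w :=
  sqrt_nsq_mulVec_le X w

omit [DecidableEq m] in
/-- `Σ_s ‖F_s‖² ≤ B²`, `0 ≤ B` ⇒ `‖F‖ ≤ B`. [folklore] -/
theorem l2T_le_of_sq_le {S : Type*} [Fintype S] {F : S → m → ℂ} {B : ℝ} (hB : 0 ≤ B)
    (h : ∑ s, nsq (F s) ≤ B ^ 2) : l2T F ≤ B := by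
  unfold l2T
  rw [← Real.sqrt_sq hB]
  exact Real.sqrt_le_sqrt h

omit [DecidableEq m] in
/-- Cauchy–Schwarz: `Σ_s ‖F_s‖ ≤ √|S| · ‖F‖`. [folklore] -/
theorem sum_l2_le {S : Type*} [Fintype S] (F : S → m → ℂ) :
    ∑ s, l2 (F s) ≤ Real.sqrt (Fintype.card S) * l2T F := by
  have hcs := sq_sum_le_card_mul_sum_sq (s := (Finset.univ : Finset S)) (f := fun s => l2 (F s))
  simp only [l2_sq, Finset.card_univ] at hcs
  have h := (le_abs_self _).trans (Real.abs_le_sqrt hcs)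
  rwa [Real.sqrt_mul (Nat.cast_nonneg _)] at h

variable {S : Type*} [Fintype S]

/-- OUT-aggregation: if `‖X_s‖ ≤ C` for all `s ∈ S` then `‖(X_s v)_s‖ ≤ √|S|·C·‖v‖`. [folklore] -/
theorem l2T_mulVec_le {X : S → Matrix m m ℂ} {C : ℝ} (hC : 0 ≤ C) (hX : ∀ s, ‖X s‖ ≤ C)
    (v : m → ℂ) : l2T (fun s => X s *ᵥ v) ≤ Real.sqrt (Fintype.card S) * C * l2 v := by
  refine l2T_le_of_sq_le (mul_nonneg (mul_nonneg (Real.sqrt_nonneg _) hC) (l2_nonneg v)) ?_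
  calc ∑ s, nsq (X s *ᵥ v) ≤ ∑ _s : S, (C * l2 v) ^ 2 := Finset.sum_le_sum fun s _ => by
          rw [← l2_sq]
          exact pow_le_pow_left₀ (l2_nonneg _)
            ((l2_mulVec_le _ _).trans (mul_le_mul_of_nonneg_right (hX s) (l2_nonneg v))) 2
    _ = (Real.sqrt (Fintype.card S) * C * l2 v) ^ 2 := by
          rw [Finset.sum_const, Finset.card_univ, nsmul_eq_mul,
            show (Real.sqrt (Fintype.card S) * C * l2 v) ^ 2
              = Real.sqrt (Fintype.card S) ^ 2 * (C * l2 v) ^ 2 by ring,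
            Real.sq_sqrt (Nat.cast_nonneg _)]

/-- IN-aggregation: if `‖X_s‖ ≤ C` for all `s ∈ S` then `‖Σ_s X_s v_s‖ ≤ √|S|·C·‖(v_s)_s‖`.
[folklore] -/
theorem l2_sum_mulVec_le {X : S → Matrix m m ℂ} {C : ℝ} (hC : 0 ≤ C) (hX : ∀ s, ‖X s‖ ≤ C)
    (v : S → m → ℂ) : l2 (∑ s, X s *ᵥ v s) ≤ Real.sqrt (Fintype.card S) * C * l2T v := by
  have h1 : l2 (∑ s, X s *ᵥ v s) ≤ C * ∑ s, l2 (v s) := by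
    calc l2 (∑ s, X s *ᵥ v s) ≤ ∑ s, l2 (X s *ᵥ v s) := l2_sum_le _ _
      _ ≤ ∑ s, C * l2 (v s) := Finset.sum_le_sum fun s _ =>
          (l2_mulVec_le _ _).trans (mul_le_mul_of_nonneg_right (hX s) (l2_nonneg _))
      _ = C * ∑ s, l2 (v s) := (Finset.mul_sum _ _ _).symm
  calc l2 (∑ s, X s *ᵥ v s) ≤ C * ∑ s, l2 (v s) := h1
    _ ≤ C * (Real.sqrt (Fintype.card S) * l2T v) := mul_le_mul_of_nonneg_left (sum_l2_le v) hC
    _ = Real.sqrt (Fintype.card S) * C * l2T v := by ring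

/-- IN-OUT-aggregation: if `‖X_{t,s}‖ ≤ C` for all `t ∈ T`, `s ∈ S` then
`‖(Σ_s X_{t,s} v_s)_t‖ ≤ √|T|·√|S|·C·‖(v_s)_s‖`. [folklore] -/
theorem l2T_sum_mulVec_le {T : Type*} [Fintype T] {X : T → S → Matrix m m ℂ} {C : ℝ}
    (hC : 0 ≤ C) (hX : ∀ t s, ‖X t s‖ ≤ C) (v : S → m → ℂ) :
    l2T (fun t => ∑ s, X t s *ᵥ v s)
      ≤ Real.sqrt (Fintype.card T) * Real.sqrt (Fintype.card S) * C * l2T v := by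
  refine l2T_le_of_sq_le (mul_nonneg (mul_nonneg (mul_nonneg (Real.sqrt_nonneg _)
    (Real.sqrt_nonneg _)) hC) (l2T_nonneg v)) ?_
  calc ∑ t, nsq (∑ s, X t s *ᵥ v s)
        ≤ ∑ _t : T, (Real.sqrt (Fintype.card S) * C * l2T v) ^ 2 :=
          Finset.sum_le_sum fun t _ => by
            rw [← l2_sq]
            exact pow_le_pow_left₀ (l2_nonneg _) (l2_sum_mulVec_le hC (hX t) v) 2
    _ = (Real.sqrt (Fintype.card T) * Real.sqrt (Fintype.card S) * C * l2T v) ^ 2 := by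
          rw [Finset.sum_const, Finset.card_univ, nsmul_eq_mul,
            show (Real.sqrt (Fintype.card T) * Real.sqrt (Fintype.card S) * C * l2T v) ^ 2
              = Real.sqrt (Fintype.card T) ^ 2 * (Real.sqrt (Fintype.card S) * C * l2T v) ^ 2
              by ring,
            Real.sq_sqrt (Nat.cast_nonneg _)]

end L2

/-! ## §2 The constant `γ₀(d, a)` (OURS; the paper prints none) -/

/-- OUR `γ₀(d,a) := 1/((d+1)²·Cst(d,a))`, `Cst(d,a) = max(γ₀^{fiber}(d,a), 1/a, 1)` the (1.89)
constant of pass 3; a function of `d` and `a` only — «independent of k, T_η, and depending on d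
only (if we put a = 1)». [folklore] -/
def gammaZero (d : ℕ) (a : ℝ) : ℝ := 1 / ((d + 1 : ℝ) ^ 2 * Cst d a)

section Constant

variable (d : ℕ) (a : ℝ)

/-- `0 < Cst(d,a)`. [folklore] -/
theorem Cst_pos : 0 < Cst d a := lt_of_lt_of_le one_pos (one_le_Cst (d := d) a)

/-- `0 < γ₀(d,a)`. [folklore] -/
theorem gammaZero_pos : 0 < gammaZero d a := by
  have := Cst_pos d a
  unfold gammaZero
  positivity

/-- `γ₀⁻¹ = (d+1)²·Cst(d,a)`. [folklore] -/
theorem gammaZero_inv : (gammaZero d a)⁻¹ = (d + 1 : ℝ) ^ 2 * Cst d a := by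
  rw [gammaZero, one_div, inv_inv]

/-- `t ≤ (d+1)²` ⇒ `t·Cst ≤ γ₀⁻¹`. [folklore] -/
theorem mul_Cst_le_gammaZero_inv {t : ℝ} (ht : t ≤ (d + 1 : ℝ) ^ 2) :
    t * Cst d a ≤ (gammaZero d a)⁻¹ := by
  rw [gammaZero_inv]
  exact mul_le_mul_of_nonneg_right ht (Cst_pos d a).le

/-- `Cst ≤ γ₀⁻¹`. [folklore] -/
theorem Cst_le_gammaZero_inv : Cst d a ≤ (gammaZero d a)⁻¹ := by
  have hd : (0 : ℝ) ≤ d := Nat.cast_nonneg d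
  have h := mul_Cst_le_gammaZero_inv d a (t := 1) (by nlinarith [hd])
  rwa [one_mul] at h

/-- `d ≤ (d+1)²`. [folklore] -/
theorem nat_le_sq : (d : ℝ) ≤ (d + 1 : ℝ) ^ 2 := by nlinarith [(Nat.cast_nonneg d : (0 : ℝ) ≤ d)]

/-- `√d ≤ (d+1)²`. [folklore] -/
theorem sqrt_nat_le_sq : Real.sqrt d ≤ (d + 1 : ℝ) ^ 2 := by
  rw [Real.sqrt_le_left (by positivity)]
  have hd : (0 : ℝ) ≤ d := Nat.cast_nonneg d
  have h1 : (1 : ℝ) ≤ (d + 1 : ℝ) ^ 2 := by nlinarith [hd]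
  have h2 : (d + 1 : ℝ) ^ 2 ≤ ((d + 1 : ℝ) ^ 2) ^ 2 := by nlinarith [h1]
  exact (nat_le_sq d).trans h2

/-- `d·Cst ≤ γ₀⁻¹`. [folklore] -/
theorem nat_mul_Cst_le : (d : ℝ) * Cst d a ≤ (gammaZero d a)⁻¹ :=
  mul_Cst_le_gammaZero_inv d a (nat_le_sq d)

/-- `√d·Cst ≤ γ₀⁻¹`. [folklore] -/
theorem sqrt_mul_Cst_le : Real.sqrt d * Cst d a ≤ (gammaZero d a)⁻¹ :=
  mul_Cst_le_gammaZero_inv d a (sqrt_nat_le_sq d)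

/-- `γ₀ ≤ 1/((d+1)·Cst)`, the (1.90) constant of pass 6. [folklore] -/
theorem gammaZero_le_gamma : gammaZero d a ≤ 1 / ((d + 1 : ℝ) * Cst d a) := by
  have hC := Cst_pos d a
  unfold gammaZero
  apply one_div_le_one_div_of_le (by positivity)
  have hd : (0 : ℝ) ≤ d := Nat.cast_nonneg d
  have h : 0 ≤ (d : ℝ) * ((d : ℝ) + 1) * Cst d a := by positivity
  nlinarith [h]

/-- `√|Fin d × Fin d| = d`. [folklore] -/
theorem sqrt_card_fin_prod : Real.sqrt ((Fintype.card (Fin d × Fin d) : ℕ) : ℝ) = d := by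
  rw [Fintype.card_prod, Fintype.card_fin, Nat.cast_mul, Real.sqrt_mul_self (Nat.cast_nonneg _)]

/-- `√|Fin d| = √d`. [folklore] -/
theorem sqrt_card_fin : Real.sqrt ((Fintype.card (Fin d) : ℕ) : ℝ) = Real.sqrt d := by
  rw [Fintype.card_fin]

end Constant

/-! ## §3 The printed tensor calculus: gradient and divergence of vector / tensor fields -/

section Lattice

variable {d : ℕ} (n : ℕ) [NeZero n] (hn : 1 ≤ n) (M : Fin d → ℕ) [hM : ∀ μ, NeZero (M μ)]
  (a : ℝ) (ha : 0 < a)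

/-- the gradient of a vector field: `(∇B)_ν = ∇_ν B` (componentwise forward differences (1.31)).
[cite: Balaban1984PropagatorsI, (1.31) p.23, (1.89) p.33] -/
def grad (B : Tor (fine n M) × Fin d → ℂ) : Fin d → (Tor (fine n M) × Fin d → ℂ) :=
  fun ν => fdiff (fine n M) (n : ℂ) ν *ᵥ B

/-- the second gradient: `(∇∇B)_{νν′} = ∇_ν ∇_{ν′} B`. [cite: Balaban1984PropagatorsI, (1.89) p.33] -/
def grad2 (B : Tor (fine n M) × Fin d → ℂ) : Fin d × Fin d → (Tor (fine n M) × Fin d → ℂ) :=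
  fun p => fdiff (fine n M) (n : ℂ) p.1 *ᵥ (fdiff (fine n M) (n : ℂ) p.2 *ᵥ B)

/-- the divergence of a 2-tensor field `J = (J_ν)_ν`: `∇*J = Σ_ν ∇_ν^* J_ν`.
[cite: Balaban1984PropagatorsI, (1.89) p.33] -/
def divT (J : Fin d → (Tor (fine n M) × Fin d → ℂ)) : Tor (fine n M) × Fin d → ℂ :=
  ∑ ν, star (fdiff (fine n M) (n : ℂ) ν) *ᵥ J ν

/-- the double divergence of a 3-tensor field `J = (J_{νν′})`: `∇*∇*J = Σ_{ν,ν′} ∇_ν^*∇_{ν′}^* J_{νν′}`.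
[cite: Balaban1984PropagatorsI, (1.89) p.33] -/
def divT2 (J : Fin d × Fin d → (Tor (fine n M) × Fin d → ℂ)) : Tor (fine n M) × Fin d → ℂ :=
  ∑ p, star (fdiff (fine n M) (n : ℂ) p.1) *ᵥ (star (fdiff (fine n M) (n : ℂ) p.2) *ᵥ J p)

include hn ha

/-! ## §4 «The operator G is a symmetric operator» and the two second-order bounds of (1.89) -/

/-- «The operator G is a symmetric operator on L²(T_η)»: `G = Δ_a⁻¹` is Hermitian.
[cite: Balaban1984PropagatorsI, Prop. 1.1 p.33 (proof ours)] -/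
theorem DeltaA_inv_isHermitian : ((DeltaA n M a)⁻¹).IsHermitian :=
  (DeltaA_isHermitian n hn M a ha).inv

/-- `G = Δ_a⁻¹` is positive definite. [cite: Balaban1984PropagatorsI, (1.71)–(1.73) p.30
(proof ours)] -/
theorem DeltaA_inv_posDef : ((DeltaA n M a)⁻¹).PosDef :=
  (DeltaA_posDef n hn M a ha).inv

/-- (1.89), fifth bound, for `G = Δ_a⁻¹`: `‖∇_ν ∇_{ν′} Δ_a⁻¹‖ ≤ Cst(d,a)`.
[cite: Balaban1984PropagatorsI, Prop. 1.1 (1.89) p.33 (kernel version; proof ours)] -/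
theorem opNorm_fdiff_fdiff_DeltaA_inv_le (ν ν' : Fin d) :
    ‖fdiff (fine n M) (n : ℂ) ν * fdiff (fine n M) (n : ℂ) ν' * (DeltaA n M a)⁻¹‖ ≤ Cst d a := by
  rw [← calG_eq_DeltaA_inv n hn M a ha]
  exact opNorm_fdiff_fdiff_calG_le n hn M a ha ν ν'

/-- (1.89), sixth bound, for `G = Δ_a⁻¹`: `‖Δ_a⁻¹ ∇_ν^* ∇_{ν′}^*‖ ≤ Cst(d,a)`.
[cite: Balaban1984PropagatorsI, Prop. 1.1 (1.89) p.33 (kernel version; proof ours)] -/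
theorem opNorm_DeltaA_inv_star_fdiff_star_fdiff_le (ν ν' : Fin d) :
    ‖(DeltaA n M a)⁻¹ * star (fdiff (fine n M) (n : ℂ) ν) * star (fdiff (fine n M) (n : ℂ) ν')‖
      ≤ Cst d a := by
  rw [← calG_eq_DeltaA_inv n hn M a ha]
  exact opNorm_calG_star_fdiff_star_fdiff_le n hn M a ha ν ν'

/-- the six componentwise operator-norm bounds of (1.89) with the single constant `γ₀(d,a)⁻¹`.
[cite: Balaban1984PropagatorsI, Prop. 1.1 (1.89) p.33 (kernel version; constant and proof ours)] -/
theorem ineq189_opNorm (ν ν' : Fin d) :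
    ‖(DeltaA n M a)⁻¹‖ ≤ (gammaZero d a)⁻¹ ∧
    ‖fdiff (fine n M) (n : ℂ) ν * (DeltaA n M a)⁻¹‖ ≤ (gammaZero d a)⁻¹ ∧
    ‖(DeltaA n M a)⁻¹ * star (fdiff (fine n M) (n : ℂ) ν)‖ ≤ (gammaZero d a)⁻¹ ∧
    ‖fdiff (fine n M) (n : ℂ) ν * (DeltaA n M a)⁻¹ * star (fdiff (fine n M) (n : ℂ) ν')‖
      ≤ (gammaZero d a)⁻¹ ∧
    ‖fdiff (fine n M) (n : ℂ) ν * fdiff (fine n M) (n : ℂ) ν' * (DeltaA n M a)⁻¹‖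
      ≤ (gammaZero d a)⁻¹ ∧
    ‖(DeltaA n M a)⁻¹ * star (fdiff (fine n M) (n : ℂ) ν) * star (fdiff (fine n M) (n : ℂ) ν')‖
      ≤ (gammaZero d a)⁻¹ :=
  ⟨(opNorm_DeltaA_inv_le n hn M a ha).trans (Cst_le_gammaZero_inv d a),
   (opNorm_fdiff_DeltaA_inv_le n hn M a ha ν).trans (Cst_le_gammaZero_inv d a),
   (opNorm_DeltaA_inv_star_fdiff_le n hn M a ha ν).trans (Cst_le_gammaZero_inv d a),
   (opNorm_fdiff_DeltaA_inv_star_fdiff_le n hn M a ha ν ν').trans (Cst_le_gammaZero_inv d a),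
   (opNorm_fdiff_fdiff_DeltaA_inv_le n hn M a ha ν ν').trans (Cst_le_gammaZero_inv d a),
   (opNorm_DeltaA_inv_star_fdiff_star_fdiff_le n hn M a ha ν ν').trans
     (Cst_le_gammaZero_inv d a)⟩

/-! ## §5 (1.89) in the printed tensor form, one constant `γ₀(d,a)⁻¹` -/

/-- (1.89): `‖GJ‖ ≤ γ₀⁻¹‖J‖`. [cite: Balaban1984PropagatorsI, Prop. 1.1 (1.89) p.33 (kernel
version; constant and proof ours)] -/
theorem ineq189_G (J : Tor (fine n M) × Fin d → ℂ) :
    l2 ((DeltaA n M a)⁻¹ *ᵥ J) ≤ (gammaZero d a)⁻¹ * l2 J :=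
  (l2_mulVec_le _ _).trans (mul_le_mul_of_nonneg_right
    ((opNorm_DeltaA_inv_le n hn M a ha).trans (Cst_le_gammaZero_inv d a)) (l2_nonneg _))

/-- (1.89): `‖∇GJ‖ ≤ γ₀⁻¹‖J‖`. [cite: Balaban1984PropagatorsI, Prop. 1.1 (1.89) p.33 (kernel
version; constant and proof ours)] -/
theorem ineq189_gradG (J : Tor (fine n M) × Fin d → ℂ) :
    l2T (grad n M ((DeltaA n M a)⁻¹ *ᵥ J)) ≤ (gammaZero d a)⁻¹ * l2 J := by
  have h : grad n M ((DeltaA n M a)⁻¹ *ᵥ J)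
      = fun ν => (fdiff (fine n M) (n : ℂ) ν * (DeltaA n M a)⁻¹) *ᵥ J := by
    funext ν
    simp [grad, Matrix.mulVec_mulVec]
  rw [h]
  refine (l2T_mulVec_le (Cst_nonneg d a)
    (fun ν => opNorm_fdiff_DeltaA_inv_le n hn M a ha ν) J).trans ?_
  rw [sqrt_card_fin]
  exact mul_le_mul_of_nonneg_right (sqrt_mul_Cst_le d a) (l2_nonneg _)

/-- (1.89): `‖G∇*J‖ ≤ γ₀⁻¹‖J‖`. [cite: Balaban1984PropagatorsI, Prop. 1.1 (1.89) p.33 (kernel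
version; constant and proof ours)] -/
theorem ineq189_GdivT (J : Fin d → (Tor (fine n M) × Fin d → ℂ)) :
    l2 ((DeltaA n M a)⁻¹ *ᵥ divT n M J) ≤ (gammaZero d a)⁻¹ * l2T J := by
  have h : (DeltaA n M a)⁻¹ *ᵥ divT n M J
      = ∑ ν, ((DeltaA n M a)⁻¹ * star (fdiff (fine n M) (n : ℂ) ν)) *ᵥ J ν := by
    simp [divT, Matrix.mulVec_sum, Matrix.mulVec_mulVec]
  rw [h]
  refine (l2_sum_mulVec_le (Cst_nonneg d a)
    (fun ν => opNorm_DeltaA_inv_star_fdiff_le n hn M a ha ν) J).trans ?_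
  rw [sqrt_card_fin]
  exact mul_le_mul_of_nonneg_right (sqrt_mul_Cst_le d a) (l2T_nonneg _)

/-- (1.89): `‖∇G∇*J‖ ≤ γ₀⁻¹‖J‖`. [cite: Balaban1984PropagatorsI, Prop. 1.1 (1.89) p.33 (kernel
version; constant and proof ours)] -/
theorem ineq189_gradGdivT (J : Fin d → (Tor (fine n M) × Fin d → ℂ)) :
    l2T (grad n M ((DeltaA n M a)⁻¹ *ᵥ divT n M J)) ≤ (gammaZero d a)⁻¹ * l2T J := by
  have h : grad n M ((DeltaA n M a)⁻¹ *ᵥ divT n M J)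
      = fun ν => ∑ ν', (fdiff (fine n M) (n : ℂ) ν * (DeltaA n M a)⁻¹
          * star (fdiff (fine n M) (n : ℂ) ν')) *ᵥ J ν' := by
    funext ν
    simp [grad, divT, Matrix.mulVec_sum, Matrix.mulVec_mulVec, Matrix.mul_assoc]
  rw [h]
  refine (l2T_sum_mulVec_le (T := Fin d) (S := Fin d)
    (X := fun ν ν' => fdiff (fine n M) (n : ℂ) ν * (DeltaA n M a)⁻¹
      * star (fdiff (fine n M) (n : ℂ) ν'))
    (Cst_nonneg d a) (fun ν ν' => opNorm_fdiff_DeltaA_inv_star_fdiff_le n hn M a ha ν ν') J).trans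
    ?_
  rw [sqrt_card_fin, Real.mul_self_sqrt (Nat.cast_nonneg _)]
  exact mul_le_mul_of_nonneg_right (nat_mul_Cst_le d a) (l2T_nonneg _)

/-- (1.89): `‖∇∇GJ‖ ≤ γ₀⁻¹‖J‖`. [cite: Balaban1984PropagatorsI, Prop. 1.1 (1.89) p.33 (kernel
version; constant and proof ours)] -/
theorem ineq189_grad2G (J : Tor (fine n M) × Fin d → ℂ) :
    l2T (grad2 n M ((DeltaA n M a)⁻¹ *ᵥ J)) ≤ (gammaZero d a)⁻¹ * l2 J := by
  have h : grad2 n M ((DeltaA n M a)⁻¹ *ᵥ J)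
      = fun p : Fin d × Fin d => (fdiff (fine n M) (n : ℂ) p.1 * fdiff (fine n M) (n : ℂ) p.2
          * (DeltaA n M a)⁻¹) *ᵥ J := by
    funext p
    simp [grad2, Matrix.mulVec_mulVec, Matrix.mul_assoc]
  rw [h]
  refine (l2T_mulVec_le (S := Fin d × Fin d)
    (X := fun p => fdiff (fine n M) (n : ℂ) p.1 * fdiff (fine n M) (n : ℂ) p.2 * (DeltaA n M a)⁻¹)
    (Cst_nonneg d a) (fun p => opNorm_fdiff_fdiff_DeltaA_inv_le n hn M a ha p.1 p.2) J).trans ?_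
  rw [sqrt_card_fin_prod]
  exact mul_le_mul_of_nonneg_right (nat_mul_Cst_le d a) (l2_nonneg _)

/-- (1.89): `‖G∇*∇*J‖ ≤ γ₀⁻¹‖J‖`. [cite: Balaban1984PropagatorsI, Prop. 1.1 (1.89) p.33 (kernel
version; constant and proof ours)] -/
theorem ineq189_GdivT2 (J : Fin d × Fin d → (Tor (fine n M) × Fin d → ℂ)) :
    l2 ((DeltaA n M a)⁻¹ *ᵥ divT2 n M J) ≤ (gammaZero d a)⁻¹ * l2T J := by
  have h : (DeltaA n M a)⁻¹ *ᵥ divT2 n M J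
      = ∑ p : Fin d × Fin d, ((DeltaA n M a)⁻¹ * star (fdiff (fine n M) (n : ℂ) p.1)
          * star (fdiff (fine n M) (n : ℂ) p.2)) *ᵥ J p := by
    simp [divT2, Matrix.mulVec_sum, Matrix.mulVec_mulVec, Matrix.mul_assoc]
  rw [h]
  refine (l2_sum_mulVec_le (S := Fin d × Fin d)
    (X := fun p => (DeltaA n M a)⁻¹ * star (fdiff (fine n M) (n : ℂ) p.1)
      * star (fdiff (fine n M) (n : ℂ) p.2))
    (Cst_nonneg d a) (fun p => opNorm_DeltaA_inv_star_fdiff_star_fdiff_le n hn M a ha p.1 p.2)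
    J).trans ?_
  rw [sqrt_card_fin_prod]
  exact mul_le_mul_of_nonneg_right (nat_mul_Cst_le d a) (l2T_nonneg _)

/-! ## §6 (1.90) with the same constant -/

open scoped MatrixOrder in
/-- **(1.90) `γ₀(Δ + I) ≤ Δ_a`** in the Löwner order, `γ₀ = gammaZero d a`.
[cite: Balaban1984PropagatorsI, Prop. 1.1 (1.90) p.33 (kernel version; constant and proof ours)] -/
theorem ineq190 : ((gammaZero d a : ℝ) : ℂ) • (Lap n M + 1) ≤ DeltaA n M a := by
  have h1 := smul_LapOne_le_DeltaA n hn M a ha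
  have h2 : ((gammaZero d a : ℝ) : ℂ) • (Lap n M + 1)
      ≤ (((1 / ((d + 1 : ℝ) * Cst d a)) : ℝ) : ℂ) • (Lap n M + 1) := by
    rw [Matrix.le_iff, ← sub_smul, ← Complex.ofReal_sub, ← sum_VbH_Vb, Finset.smul_sum]
    exact Matrix.posSemidef_sum _ fun α _ =>
      smul_gram_posSemidef _ (sub_nonneg.mpr (gammaZero_le_gamma d a)) _
  exact h2.trans h1

/-- (1.90) as quadratic forms: `γ₀ ⟨A, (Δ + I)A⟩ ≤ ⟨A, Δ_a A⟩` for every vector field `A`.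
[cite: Balaban1984PropagatorsI, Prop. 1.1 (1.90) p.33 (kernel version; constant and proof ours)] -/
theorem ineq190_form (A : Tor (fine n M) × Fin d → ℂ) :
    gammaZero d a * (star A ⬝ᵥ ((Lap n M + 1) *ᵥ A)).re
      ≤ (star A ⬝ᵥ (DeltaA n M a *ᵥ A)).re := by
  have h := lowerBound_re n hn M a ha A
  rw [calDa_eq_DeltaA n hn M a ha] at h
  refine le_trans ?_ h
  have hnn : 0 ≤ (star A ⬝ᵥ ((Lap n M + 1) *ᵥ A)).re := by
    rw [form_LapOne, Complex.ofReal_re]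
    exact Finset.sum_nonneg fun _ _ => nsq_nonneg _
  exact mul_le_mul_of_nonneg_right (gammaZero_le_gamma d a) hnn

end Lattice

/-! ## §7 Proposition 1.1 in the printed quantifier order -/

open scoped MatrixOrder in
/-- **Proposition 1.1 (B5 p. 33) for the typed lattice operators**: for every dimension `d` and
every `a > 0` there is ONE constant `γ₀ > 0` — «independent of k, T_η» — such that for EVERY
`n ≥ 1` (`η = 1/n = L^{-k}`) and EVERY coarse torus `M` (`T_η = Tor (fine n M)`): `G = Δ_a⁻¹` is
symmetric, the six bounds (1.89) hold with `γ₀⁻¹` (tensor reading, see the module docstring), and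
(1.90) `γ₀(Δ + I) ≤ Δ_a` holds. [cite: Balaban1984PropagatorsI, Prop. 1.1 (1.89)–(1.90) p.33
(kernel version for the typed operators; constant and proof ours)] -/
theorem prop11_lattice {d : ℕ} (a : ℝ) (ha : 0 < a) :
    ∃ γ₀ : ℝ, 0 < γ₀ ∧ ∀ (n : ℕ) [NeZero n], 1 ≤ n → ∀ (M : Fin d → ℕ) [∀ μ, NeZero (M μ)],
      ((DeltaA n M a)⁻¹).IsHermitian ∧
      (∀ J, l2 ((DeltaA n M a)⁻¹ *ᵥ J) ≤ γ₀⁻¹ * l2 J) ∧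
      (∀ J, l2T (grad n M ((DeltaA n M a)⁻¹ *ᵥ J)) ≤ γ₀⁻¹ * l2 J) ∧
      (∀ J, l2 ((DeltaA n M a)⁻¹ *ᵥ divT n M J) ≤ γ₀⁻¹ * l2T J) ∧
      (∀ J, l2T (grad n M ((DeltaA n M a)⁻¹ *ᵥ divT n M J)) ≤ γ₀⁻¹ * l2T J) ∧
      (∀ J, l2T (grad2 n M ((DeltaA n M a)⁻¹ *ᵥ J)) ≤ γ₀⁻¹ * l2 J) ∧
      (∀ J, l2 ((DeltaA n M a)⁻¹ *ᵥ divT2 n M J) ≤ γ₀⁻¹ * l2T J) ∧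
      ((γ₀ : ℂ) • (Lap n M + 1) ≤ DeltaA n M a) :=
  ⟨gammaZero d a, gammaZero_pos d a, fun n _ hn M _ =>
    ⟨DeltaA_inv_isHermitian n hn M a ha,
     fun J => ineq189_G n hn M a ha J,
     fun J => ineq189_gradG n hn M a ha J,
     fun J => ineq189_GdivT n hn M a ha J,
     fun J => ineq189_gradGdivT n hn M a ha J,
     fun J => ineq189_grad2G n hn M a ha J,
     fun J => ineq189_GdivT2 n hn M a ha J,
     ineq190 n hn M a ha⟩⟩

open scoped MatrixOrder in
/-- Proposition 1.1 at `a = 1`: «with a positive constant γ₀ independent of k, T_η, and depending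
on d only (if we put a = 1)». [cite: Balaban1984PropagatorsI, Prop. 1.1 (1.89)–(1.90) p.33
(kernel version for the typed operators; constant and proof ours)] -/
theorem prop11_lattice_one (d : ℕ) :
    ∃ γ₀ : ℝ, 0 < γ₀ ∧ ∀ (n : ℕ) [NeZero n], 1 ≤ n → ∀ (M : Fin d → ℕ) [∀ μ, NeZero (M μ)],
      ((DeltaA n M 1)⁻¹).IsHermitian ∧
      (∀ J, l2 ((DeltaA n M 1)⁻¹ *ᵥ J) ≤ γ₀⁻¹ * l2 J) ∧
      (∀ J, l2T (grad n M ((DeltaA n M 1)⁻¹ *ᵥ J)) ≤ γ₀⁻¹ * l2 J) ∧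
      (∀ J, l2 ((DeltaA n M 1)⁻¹ *ᵥ divT n M J) ≤ γ₀⁻¹ * l2T J) ∧
      (∀ J, l2T (grad n M ((DeltaA n M 1)⁻¹ *ᵥ divT n M J)) ≤ γ₀⁻¹ * l2T J) ∧
      (∀ J, l2T (grad2 n M ((DeltaA n M 1)⁻¹ *ᵥ J)) ≤ γ₀⁻¹ * l2 J) ∧
      (∀ J, l2 ((DeltaA n M 1)⁻¹ *ᵥ divT2 n M J) ≤ γ₀⁻¹ * l2T J) ∧
      ((γ₀ : ℂ) • (Lap n M + 1) ≤ DeltaA n M 1) :=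
  prop11_lattice (d := d) 1 one_pos

end

end Literature.MathematicalPhysics.QuantumFieldTheory.Balaban1983to89.B5Prop11Lattice
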